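import Summits.BirchSwinnertonDyer.Rank1Residual.Additive.DisegniLineEndStateOdd
import Summits.BirchSwinnertonDyer.Rank1Residual.Additive.TwistedBranchPAdicGrossZagierEndStateThree
import Literature.NumberTheory.EllipticCurves.Disegni2017.CycLineGrossZagierFactThree
import HarnessLib

/-!
# STEP C⁻(3) at `p = 3`, ANOMALOUS OR NOT: X3♯(G-ord) ∩ `r_an = 1` — `BSD(E,3)` from published facts,
# hna-free (cell `bsd-addord`, seat `bsd-addord-gz` gen 4)

HONEST FRAMING (cell `bsd-addord`; PARTITION (D-0054): EXCLUDED-DOMAIN additive rows §E (B6 = O7-ord r1) at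
`p = 3`: X3♯(G-ord, e = 2) ∩ r_an = 1 ∩ ¬CM, ANOMALOUS OR NOT, with the per-pair `3`-line datum
`X3LineDatumThree W` (680 bx3g r1 keys typed; 138 of them anomalous, unreachable by the sibling
`DisegniLineEndStateThree` which needs `ReductionNonAnomalous W 3`) — types-the-object-of per E; booked 0).
THEOREMS ONLY. This is `ClassX3Gord.bsdp_three_rankOne_of_facts_of_cycLineFact[_of_lineDatum]_of_branchCoeffOneNeZero`
(p417447) with the non-anomalous hypothesis `hna` REMOVED, exactly as the `p ≡ 1 (mod 4)` road did in
`ClassX3Gord.bsdp_rankOne_of_facts_of_cycLineFact_intrinsic_of_branchCoeffOneNeZero` (p414600): the lower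
half runs in the intrinsic currency of Delbourgo 2002 Thm. (B) (`LeadingTermClausesIntrinsic`, factor
`[E(ℚ_3):N_∞E(ℚ_3)]/c_3`) through `missingLowerBoundAt_of_cycLowerBound_of_not_dvd_index`, the index being
prime to `3` by Mazur 1972 Cor. 5.15 (`hMaz`) transported through the good ordinary twist
(`ClassX3Gord.not_dvd_localUniversalNormIndex_of_facts`, `e = 2` at `3` by
`semistabilityIndex_eq_two_of_typeG_three`). The datum comes from the `p = 3` conjoined fact WITH the
intrinsic conjunct, `Disegni2017.delbourgoDatum_cycLineGrossZagier_intrinsicThree` (lit g14, p418820; binder `hCyc3`; Delbourgo's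
Hypothesis second bullet, both displayed hypotheses discharged on the class: `TypeGOrd W 3` and
`TypeGOrd.exists_goodOrd_twist_model_three`). Everything else — (L) odd-branch lifting chain, the twist
model / newforms / Waldspurger field / Kronecker data, STEP C⁻(2) identity, (S), upper half — is the
sibling's, verbatim. Remaining non-published inputs: the per-pair line datum and the analytic number
`BranchCoeffOneNeZeroAt W 3` (two-engine certificates, HOME/proof/gz5-p3/).

References: [Disegni2017] Thm. A/B, (1.1.3); [Delbourgo2002] Thm. (A), (B), Hypothesis (p. 39), p. 67 (iv),
p. 69; [Mazur1972Towers] Cor. 5.15; [GrossZagier1986] Thm. I.(7.3); [Wuthrich2014] Thm. 16;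
[GreenbergVatsal2000] Thm. (3.12).
-/

set_option autoImplicit false

noncomputable section

open scoped Classical MatrixGroups ModularForm NumberField

open CongruenceSubgroup WeierstrassCurve NumberField IsDedekindDomain Field
  Literature.NumberTheory.EllipticCurves Literature.NumberTheory.EllipticCurves.ModularForms
  Literature.NumberTheory.EllipticCurves.GreenbergVatsal2000
  Literature.NumberTheory.EllipticCurves.Rank1Residual
  Literature.NumberTheory.EllipticCurves.Rank1Residual.Typed
  Literature.NumberTheory.EllipticCurves.Delbourgo2002
  Literature.NumberTheory.EllipticCurves.Disegni2017
  Literature.NumberTheory.GaloisRepresentations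
  Summit.BirchSwinnertonDyer.Rank1Residual.AdditivePotMult
  Summit.BirchSwinnertonDyer.Rank1Residual.Additive.X3Branch

namespace Summit.BirchSwinnertonDyer.Rank1Residual.Additive

section ThreeIntrinsic

variable {W : WeierstrassCurve ℚ} [W.IsElliptic] [W.IsGloballyMinimal]

/-- **X3♯(G-ord) (`E[3]` reducible, `e = 2`), `p = 3`, `E` non-CM, `r_an(E) = 1`, ANOMALOUS OR NOT, the
`3`-line datum: `BSD(E,3)` from PUBLISHED named facts + Mazur 1972 Cor. 5.15 + ONE analytic number** —
p417447's end state with `hna` removed: datum from `hCyc3` (the `p = 3` conjoined fact with the intrinsic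
conjunct), lower half `missingLowerBoundAt_of_cycLowerBound_of_not_dvd_index` with
`ClassX3Gord.not_dvd_localUniversalNormIndex_of_facts hMaz`.
[cite: Disegni2017, Theorem A (arXiv v3 PDF pp. 7–8), Theorem B (PDF p. 9), (1.1.3) (PDF pp. 4–5)]
[cite: Delbourgo2002, Theorem (A), (B) (p. 40); Hypothesis (p. 39); p. 67 (iv); p. 69]
[cite: Mazur1972Towers, Cor. 5.15 with Remark (p. 229)] [cite: GrossZagier1986, Thm. I.(7.3)]
[cite: Darmon2004, §3.9, proof of Thm. 3.22] [cite: Wuthrich2014, Thm. 16 (p. 397)]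
[cite: GreenbergVatsal2000, §2 (11), (16), §3 Thm. (3.12) p. 45] [cite: Miller2011LMS, Def. 1.1] -/
theorem ClassX3Gord.bsdp_three_rankOne_of_facts_of_cycLineFactThree_intrinsic_of_branchCoeffOneNeZero
    [hp : Fact (Nat.Prime 3)]
    (hW16 : Wuthrich2014.thm16_halfEigenCharIdeal_dvd_cyclotomicPrime)
    (hGV : thm312_branch_unitContent_and_lambda_eq_residual_goodOrd)
    (h23 : datumSelmer_nonPrimitive_invariants)
    (h414 : Greenberg1999.prop414_noFiniteSubmodule_of_not_dvd_torsionOrder)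
    (hGrK : Greenberg1999.imKummer_ge_strictCondition_goodOrdinary)
    (hLiftE : residualEpsilon_surjOn_of_lineEven)
    (hMaz : Mazur1972.cor515_universalNormIndex)
    (hCyc3 : delbourgoDatum_cycLineGrossZagier_intrinsicThree)
    (hArt : rankinSelbergEulerProductHecke_baseChangeDirichlet_eq) (h73 : GrossZagier1986_thm_I_7_3)
    (hWald : waldspurger_exists_heegnerField_twist_ne_zero)
    (hDel3 : Delbourgo2002.mainTheorem_three) (hmod : hasEntireLFunction_rat)
    (hmodD : nonempty_modularParametrizationData) (hmodN : exists_isNewformOf)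
    (hGZK : rank_eq_analyticRank_of_analyticRank_le_one)
    (hX : ClassX3Gord W 3) (hcm : ¬ W.HasCM) (hr : W.analyticRank = 1)
    (Φ₀ : AddSubgroup (W.geomTorsion ((3 : ℕ) : ℤ))) (hΦ : IsRationalLine W 3 Φ₀)
    (heven : LineEven W 3 Φ₀)
    (hnt : ∃ (σ : absoluteGaloisGroup ℚ) (P : W.geomTorsion ((3 : ℕ) : ℤ)), P ∈ Φ₀ ∧ σ • P ≠ P)
    (hram : ∀ (K : Type) [Field K] [NumberField K] [(galRange (K := ℚ) K).Normal],
      Module.finrank ℚ K = 2 →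
      (∃ θ : K, θ ^ 2 = algebraMap ℚ K ((-1) ^ ((3 : ℕ) / 2) * (3 : ℕ))) →
      ¬ ∀ v : HeightOneSpectrum (𝓞 ℚ), (((3 : ℕ) : ℕ) : 𝓞 ℚ) ∈ v.asIdeal →
        ∀ 𝔓 ∈ v.primesAbove, ∀ σ ∈ 𝔓.inertia (absoluteGaloisGroup ℚ), ∀ P ∈ Φ₀,
          σ • P = (if σ ∈ galRange (K := ℚ) K then P else -P))
    (hne : BranchCoeffOneNeZeroAt W 3) : BSDp W 3 := by
  have hpP : (3 : ℕ).Prime := hp.out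
  have hp4 : (3 : ℕ) % 4 = 3 := by norm_num
  have hp2 : (3 : ℕ) ≠ 2 := by norm_num
  have he : semistabilityIndex W 3 = 2 :=
    semistabilityIndex_eq_two_of_typeG_three W hX.typeGOrd.typeG hX.addv
  -- (L) from published facts + the line data + the even-line lifting, odd branch
  obtain ⟨S₀, hS₀, hS⟩ := X2.GreenbergVatsalCaseOne.exists_finset_bad_not_mem W 3
  have hdiv : ChiBranchLowerDivisibilityOddAt W 3 :=
    X3Branch.chiBranchLowerDivisibilityOddAt_of_facts_of_lifting hW16 hGV h23 h414 hGrK S₀ hS₀ hS Φ₀ hΦ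
      heven hnt hram (fun κ S₀ hκ hS₀ hS ↦ hLiftE W 3 κ S₀ Φ₀ hΦ (by norm_num) hκ heven hS₀ hS)
  -- the twist model, its newform and period ratio; the newform of `E`
  obtain ⟨V, iV, iVm, C, hV, hC⟩ := hX.exists_goodOrd_pStar_twist_model W 3 hp2 he
  have hps : ((-1 : ℚ) ^ ((3 : ℕ) / 2) * ((3 : ℕ) : ℚ)) = -((3 : ℕ) : ℚ) := by norm_num
  have hC' : C • V.quadraticTwist (-((3 : ℕ) : ℚ)) = W := by rw [← hps]; exact hC
  have hVW : ∃ C : VariableChange ℚ, C • V.quadraticTwist (-((3 : ℕ) : ℚ)) = W := ⟨C, hC'⟩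
  have hordin : IsOrdinaryAt V 3 := ⟨hV.1, hV.2⟩
  haveI : NeZero (V.conductorNorm ℤ) := ⟨(V.conductorNorm_pos_holds).ne'⟩
  obtain ⟨Dm⟩ := hmodD V
  obtain ⟨ϖ, -, hϖ⟩ := exists_rat_mul_imaginaryPeriodRat_eq_minusPeriod Dm
  haveI : NeZero (W.conductorNorm ℤ) := ⟨(W.conductorNorm_pos_holds).ne'⟩
  obtain ⟨DmW⟩ := hmodD W
  -- the Heegner field with `L(E^{(d_K)}, 1) ≠ 0` (Waldspurger)
  have hroot : W.rootNumber = -1 := by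
    rcases rootNumber_eq_one_or_eq_neg_one W with h1 | h1
    · exfalso
      have hev1 : Even W.analyticRank :=
        (even_analyticRank_iff_rootNumber_eq_one_of_exists_isNewformOf W hmodN).mpr h1
      rw [hr] at hev1
      exact Nat.not_even_one hev1
    · exact h1
  obtain ⟨K, _, _, hK, -, hHeeg, hLd⟩ := hWald W hroot 0
  have h2 : Module.finrank ℚ K = 2 := hK.1
  haveI : IsGalois ℚ K := isGalois_of_finrank_eq_two K h2
  have hdq : (NumberField.discr K : ℚ) ≠ 0 := by exact_mod_cast NumberField.discr_ne_zero K
  -- the Kronecker character and the twist data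
  obtain ⟨κ, hκ, hκ2, hκall⟩ := exists_kroneckerChar_twistCoeff K h2
  obtain ⟨hpd, hκW, V', iV', iVm', N', _, f', hfV', hV', hap, hordV'⟩ :=
    exists_twist_newform_neg K hmodD hmodN hp4 h2 κ hκ hκall hHeeg hX.addv V hVW hV Dm.isNewformOf
  have hpdN : Nat.Coprime 3 (NumberField.discr K).natAbs :=
    (Nat.Prime.coprime_iff_not_dvd hpP).mpr fun h ↦ hpd (Int.natCast_dvd.mpr h)
  have hS' : legendreMinusSymbolSum f' 3 ≠ 0 :=
    legendreMinusSymbolSum_ne_zero_of_twist K hmod hp4 κ hκW hX.addv V hVW Dm.isNewformOf hfV'.1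
      hfV'.coeffField_eq_bot hV' hLd
  have hrd : (W.quadraticTwist (NumberField.discr K : ℚ)).mordellWeilRank = 0 := by
    haveI := W.isElliptic_quadraticTwist hdq
    have h0 : (W.quadraticTwist (NumberField.discr K : ℚ)).analyticRank = 0 :=
      (analyticRank_eq_zero_iff_holds (hmod _)).mpr hLd
    rw [(hGZK _ (by rw [h0]; exact zero_le_one)).1, h0]
  -- the datum, in both currencies: the `p = 3` conjoined fact (Hypothesis second bullet, displayed)
  obtain ⟨ι⟩ := PadicAlgCl.nonempty_ringEquiv_complex (p := 3)
  have hpstar : ((pStar 3 : ℤ) : ℚ) = -((3 : ℕ) : ℚ) := by rw [pStar]; norm_num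
  have hCps : C • V.quadraticTwist (pStar 3 : ℚ) = W := by rw [hpstar]; exact hC'
  obtain ⟨Dh, DhK, hres, hBι, hB, hGZc⟩ := hCyc3.exists_datum_intrinsic_three ι rfl hcm hX.addv hX.typeGOrd
    (hX.typeGOrd.exists_goodOrd_twist_model_three hX.addv) hr hCps (Or.inl ⟨hV.1, hordin, rfl⟩)
    DmW.isNewformOf hK hHeeg
  -- the two unit factors at the place over `3` (Mazur 1972 via the twist transport)
  set v₀ : HeightOneSpectrum (𝓞 ℚ) := (Rat.HeightOneSpectrum.primesEquiv (R := 𝓞 ℚ)).symm ⟨3, hp.out⟩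
    with hv₀_def
  have hv₀ : ((3 : ℕ) : 𝓞 ℚ) ∈ v₀.asIdeal :=
    natCast_mem_asIdeal_of_primesEquiv_eq (primesEquiv_symm_apply_coe 3)
  have hcp0 : W.tamagawaNumberAt v₀ ≠ 0 := (tamagawaNumberAt_ne_zero_and_le_four_of_addv W 3 hX.addv).1
  have hι : ∀ κ : ZpExtension ℚ 3, κ.IsCyclotomic →
      localUniversalNormIndex (W := W) (v₀.adicCompletion ℚ) κ ⊤ ≠ 0 →
      ¬ 3 ∣ localUniversalNormIndex (W := W) (v₀.adicCompletion ℚ) κ ⊤ :=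
    fun κ hκ h0 ↦ hX.not_dvd_localUniversalNormIndex_of_facts hMaz hp2 he κ hκ v₀ hv₀ h0
  -- STEP C⁻(2): the identity at `(V, f, ϖ)`
  obtain ⟨u, q, hlead, hpgz⟩ := branchPAdicGrossZagier_identity_of_cycLine_odd ι K hp4 hArt h73 hmod hGZK
    h2 κ hκ hκ2 hpdN hrd hX.addv hr V V' C hC' hV hordV' hap Dm.isNewformOf DmW.isNewformOf hfV' hV' hS' ϖ
    hϖ hres hGZc
  -- (S), lower half (intrinsic currency), upper half, glue
  have hSch : SchneiderConjecture Dh :=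
    schneiderConjecture_of_identity_of_branchCoeffOneNeZero_odd hp4 hne V C hC hordin Dm.f Dm.isNewformOf
      ϖ hϖ hpgz
  have hlow : CycLowerBoundAt W 3 Dh :=
    cycLowerBoundAt_of_chiBranchLowerOdd_of_identity W 3 hmod hGZK hX.addv hr hp4 V hVW hV Dm.isNewformOf ϖ
      hϖ hdiv hlead hpgz
  have hl : MissingLowerBoundAt W 3 :=
    missingLowerBoundAt_of_cycLowerBound_of_not_dvd_index W 3 hBι hSch
      (fun κ' γ hκ' hγ D ↦ TypeGOrd.isTorsion_three_of_delbourgo2002 hDel3 hX.typeGOrd hX.addv hcm hκ' hγ D)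
      hGZK (by rw [hr]) v₀ hv₀ hcp0 hι hlow
  have hu : MissingUpperBoundAt W 3 :=
    ClassX3Gord.missingUpperBoundAt_rankOne_of_wuthrichHalf_of_identity_odd hW16 hGZK hmod hX hp4 hr hB
      hSch V hV C hC Dm.isNewformOf ϖ hϖ hlead hpgz
  exact bsdp_of_missingPPartAt W 3 hGZK (by rw [hr]) (missingPPartAt_of_lower_of_upper W 3 hl hu)

/-- **`p = 3` with the line datum as ONE predicate, ANOMALOUS OR NOT** (per-pair records
`x3LineDatumThree_<label>`, 680 filed): `BSD(E,3)` on X3♯(G-ord, `e = 2`) ∩ `r_an = 1`, `E` non-CM, from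
PUBLISHED facts + Mazur 1972 Cor. 5.15 + `X3LineDatumThree W` + `BranchCoeffOneNeZeroAt W 3`.
[cite: Delbourgo2002, Theorem (A), (B) (p. 40), p. 67 (iv), p. 69] [cite: Disegni2017, Theorem A/B (arXiv v3 PDF 7–9)]
[cite: Mazur1972Towers, Cor. 5.15] [cite: GreenbergVatsal2000, §2 (11), (16), pp. 28–30, §3 Thm. (3.12) p. 45]
[cite: Wuthrich2014, Thm. 16 (p. 397)] [cite: Miller2011LMS, Def. 1.1] -/
theorem ClassX3Gord.bsdp_three_rankOne_of_facts_of_cycLineFactThree_intrinsic_of_lineDatum_of_branchCoeffOneNeZero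
    [Fact (Nat.Prime 3)]
    (hW16 : Wuthrich2014.thm16_halfEigenCharIdeal_dvd_cyclotomicPrime)
    (hGV : thm312_branch_unitContent_and_lambda_eq_residual_goodOrd)
    (h23 : datumSelmer_nonPrimitive_invariants)
    (h414 : Greenberg1999.prop414_noFiniteSubmodule_of_not_dvd_torsionOrder)
    (hGrK : Greenberg1999.imKummer_ge_strictCondition_goodOrdinary)
    (hLiftE : residualEpsilon_surjOn_of_lineEven)
    (hMaz : Mazur1972.cor515_universalNormIndex)
    (hCyc3 : delbourgoDatum_cycLineGrossZagier_intrinsicThree)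
    (hArt : rankinSelbergEulerProductHecke_baseChangeDirichlet_eq) (h73 : GrossZagier1986_thm_I_7_3)
    (hWald : waldspurger_exists_heegnerField_twist_ne_zero)
    (hDel3 : Delbourgo2002.mainTheorem_three) (hmod : hasEntireLFunction_rat)
    (hmodD : nonempty_modularParametrizationData) (hmodN : exists_isNewformOf)
    (hGZK : rank_eq_analyticRank_of_analyticRank_le_one)
    (hX : ClassX3Gord W 3) (hcm : ¬ W.HasCM) (hr : W.analyticRank = 1)
    (hL : X3LineDatumThree W) (hne : BranchCoeffOneNeZeroAt W 3) : BSDp W 3 := by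
  obtain ⟨Φ₀, hΦ, heven, hnt, hram⟩ := hL
  exact ClassX3Gord.bsdp_three_rankOne_of_facts_of_cycLineFactThree_intrinsic_of_branchCoeffOneNeZero hW16
    hGV h23 h414 hGrK hLiftE hMaz hCyc3 hArt h73 hWald hDel3 hmod hmodD hmodN hGZK hX hcm hr Φ₀ hΦ heven hnt
    hram hne

end ThreeIntrinsic

end Summit.BirchSwinnertonDyer.Rank1Residual.Additive

end
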